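import Mathlib
import Summits.Ventures.HodgeRepro.Tier4.Common.ConcreteForms
import Summits.Ventures.HodgeRepro.Tier4.Common.Forms

/-!
# Tier4/Common/ConcreteAlgebra — the concrete form space `d.concreteForms Γ' D` of `X_{Γ′}` and its `FormAlgebra`
modulo the two textbook residuals

Blind re-derivation cell `pub-hodge-repro`, Tier 4 (README §9–§10), seat t4-typer-1 (gen 0).  Target tree path
`lean/Summits/Ventures/HodgeRepro/Tier4/Common/ConcreteAlgebra.lean`.  Imports `Tier4/Common/ConcreteForms.lean`
(typer-1: `IsBddMeasOn`, `FormPair`, `pairingC`, `wedgeC` with their algebra) and `Tier4/Common/Forms.lean`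
(typer-1: the seam `FormAlgebra`).

WHAT IS DEFINED.  `d.concreteForms Γ' D`: the ℂ-submodule of `FormPair` of pairs `(F, h)` with `F` a `1`-form and
`h` a `2`-form coefficient of `X_{Γ′}` (`IsAutForm1`, `IsAutForm2`), both bounded measurable on `D`; `CForm d Γ' D`
its underlying type; the two named residuals **(T1)** `IsPosDefOn d Γ' D` (the pairing is positive definite on the
concrete forms — the `L²` positivity of a non-zero invariant form over a fundamental domain) and **(T2)**
`FiniteDimensional ℂ (CForm d Γ' D)` (Cartan–Serre on the compact `X_{Γ′}`).

WHAT IS PROVED.  **`concreteFormAlgebra`**: for `D ⊆ 𝔹²` measurable, given (T1) and (T2), a `FormAlgebra` on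
`CForm d Γ' D` with `wedge = wedgeC`, `hodge = pairingC D`, `H10 = {h = 0}`, `H20 = {F = 0}` — every other field
of `FormAlgebra` (wedge into `H20`, alternating, hermitian, degree-orthogonal) PROVED.  So the seam of the lines is
instantiated on the target's own objects with exactly two displayed textbook hypotheses.

Nothing here says anything about the status of the Hodge conjecture for CM abelian varieties, which is NOT proved
(HC_CM is NOT proved by anyone in this repository).
-/

set_option autoImplicit false

noncomputable section

open Matrix MeasureTheory NumberField
open scoped ComplexConjugate ComplexOrder

namespace Summit.Ventures.HodgeRepro.Tier4

open Summit.Ventures.HodgeRepro.Tier4.Common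

namespace TargetData

variable {F E : Type} [Field F] [NumberField F] [IsGalois ℚ F] [IsCMField F]
  [Field E] [NumberField E] [IsGalois ℚ E] [IsCMField E] (d : TargetData F E)

/-- A pair is a concrete form of `X_{Γ′}` over `D`: a `1`-form and a `2`-form coefficient of `X_{Γ′}`, both bounded
measurable on `D`. -/
def IsConcreteForm (Γ' : Set (Matrix (Fin 3) (Fin 3) E)) (D : Set (Fin 2 → ℂ)) (x : FormPair) : Prop :=
  d.IsAutForm1 Γ' x.1 ∧ d.IsAutForm2 Γ' x.2 ∧ IsBddMeasOn D x.1 ∧ IsBddMeasOn D x.2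

/-- **The concrete form space of `X_{Γ′}` over `D`.** -/
def concreteForms (Γ' : Set (Matrix (Fin 3) (Fin 3) E)) (D : Set (Fin 2 → ℂ)) : Submodule ℂ FormPair where
  carrier := {x | d.IsConcreteForm Γ' D x}
  add_mem' := by
    rintro x y ⟨hx1, hx2, hx3, hx4⟩ ⟨hy1, hy2, hy3, hy4⟩
    exact ⟨(d.autForms1 Γ').add_mem hx1 hy1, (d.autForms2 Γ').add_mem hx2 hy2, hx3.add hy3, hx4.add hy4⟩
  zero_mem' := ⟨(d.autForms1 Γ').zero_mem, (d.autForms2 Γ').zero_mem, IsBddMeasOn.zero, IsBddMeasOn.zero⟩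
  smul_mem' := by
    rintro c x ⟨hx1, hx2, hx3, hx4⟩
    exact ⟨(d.autForms1 Γ').smul_mem c hx1, (d.autForms2 Γ').smul_mem c hx2, hx3.smul c, hx4.smul c⟩

/-- The type of concrete forms. -/
abbrev CForm (Γ' : Set (Matrix (Fin 3) (Fin 3) E)) (D : Set (Fin 2 → ℂ)) : Type := ↥(d.concreteForms Γ' D)

/-- Membership in `concreteForms`. -/
theorem mem_concreteForms (Γ' : Set (Matrix (Fin 3) (Fin 3) E)) (D : Set (Fin 2 → ℂ)) (x : FormPair) :
    x ∈ d.concreteForms Γ' D ↔ d.IsConcreteForm Γ' D x := Iff.rfl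

/-- The bounded-measurable part of a concrete form. -/
theorem IsConcreteForm.bdd {Γ' : Set (Matrix (Fin 3) (Fin 3) E)} {D : Set (Fin 2 → ℂ)} {x : FormPair}
    (hx : d.IsConcreteForm Γ' D x) : IsBddMeasOn D x.1 ∧ IsBddMeasOn D x.2 := ⟨hx.2.2.1, hx.2.2.2⟩

/-- The wedge of two concrete forms is a concrete form. -/
theorem IsConcreteForm.wedgeC {Γ' : Set (Matrix (Fin 3) (Fin 3) E)} {D : Set (Fin 2 → ℂ)} {x y : FormPair}
    (hx : d.IsConcreteForm Γ' D x) (hy : d.IsConcreteForm Γ' D y) : d.IsConcreteForm Γ' D (Tier4.wedgeC x y) :=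
  ⟨(d.autForms1 Γ').zero_mem, d.wedgeField_isAutForm2 Γ' hx.1 hy.1, IsBddMeasOn.zero, hx.2.2.1.wedgeField hy.2.2.1⟩

/-- **(T1) — positive definiteness of the pairing on the concrete forms** (the `L²` positivity of a non-zero
invariant form over a fundamental domain; textbook, see the header). -/
def IsPosDefOn (Γ' : Set (Matrix (Fin 3) (Fin 3) E)) (D : Set (Fin 2 → ℂ)) : Prop :=
  ∀ x : d.CForm Γ' D, x ≠ 0 → 0 < (pairingC D x.1 x.1).re

/-- The `1`-forms among the concrete forms: second component zero. -/
def cH10 (Γ' : Set (Matrix (Fin 3) (Fin 3) E)) (D : Set (Fin 2 → ℂ)) : Submodule ℂ (d.CForm Γ' D) :=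
  LinearMap.ker ((LinearMap.snd ℂ _ _).comp (d.concreteForms Γ' D).subtype)

/-- The `2`-forms among the concrete forms: first component zero. -/
def cH20 (Γ' : Set (Matrix (Fin 3) (Fin 3) E)) (D : Set (Fin 2 → ℂ)) : Submodule ℂ (d.CForm Γ' D) :=
  LinearMap.ker ((LinearMap.fst ℂ _ _).comp (d.concreteForms Γ' D).subtype)

/-- Membership in `cH10`. -/
theorem mem_cH10 (Γ' : Set (Matrix (Fin 3) (Fin 3) E)) (D : Set (Fin 2 → ℂ)) (x : d.CForm Γ' D) :
    x ∈ d.cH10 Γ' D ↔ x.1.2 = 0 := by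
  simp [cH10]

/-- Membership in `cH20`. -/
theorem mem_cH20 (Γ' : Set (Matrix (Fin 3) (Fin 3) E)) (D : Set (Fin 2 → ℂ)) (x : d.CForm Γ' D) :
    x ∈ d.cH20 Γ' D ↔ x.1.1 = 0 := by
  simp [cH20]

/-- **The wedge on concrete forms**, ℂ-bilinear. -/
def cWedge (Γ' : Set (Matrix (Fin 3) (Fin 3) E)) (D : Set (Fin 2 → ℂ)) :
    d.CForm Γ' D →ₗ[ℂ] d.CForm Γ' D →ₗ[ℂ] d.CForm Γ' D :=
  LinearMap.mk₂ ℂ (fun x y => ⟨Tier4.wedgeC x.1 y.1, x.2.wedgeC d y.2⟩)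
    (fun x x' y => Subtype.ext (wedgeC_add_left x.1 x'.1 y.1))
    (fun c x y => Subtype.ext (wedgeC_smul_left c x.1 y.1))
    (fun x y y' => Subtype.ext (wedgeC_add_right x.1 y.1 y'.1))
    (fun c x y => Subtype.ext (wedgeC_smul_right c x.1 y.1))

/-- **The pairing on concrete forms**, sesquilinear (`D ⊆ 𝔹²` measurable). -/
def cHodge (Γ' : Set (Matrix (Fin 3) (Fin 3) E)) {D : Set (Fin 2 → ℂ)} (hD : D ⊆ ball) (hDm : MeasurableSet D) :
    d.CForm Γ' D →ₗ[ℂ] d.CForm Γ' D →ₗ⋆[ℂ] ℂ :=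
  LinearMap.mk₂'ₛₗ (RingHom.id ℂ) (starRingEnd ℂ) (fun x y => pairingC D x.1 y.1)
    (fun x x' y => pairingC_add_left hD hDm x.2.bdd x'.2.bdd y.2.bdd)
    (fun c x y => pairingC_smul_left D c x.1 y.1)
    (fun x y y' => pairingC_add_right hD hDm x.2.bdd y.2.bdd y'.2.bdd)
    (fun c x y => pairingC_smul_right D c x.1 y.1)

/-- **THE CONCRETE FORM ALGEBRA**: the seam `FormAlgebra` on the concrete forms of `X_{Γ′}` over a measurable
`D ⊆ 𝔹²`, given (T1) positive definiteness and (T2) finite-dimensionality — everything else proved. -/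
def concreteFormAlgebra (Γ' : Set (Matrix (Fin 3) (Fin 3) E)) {D : Set (Fin 2 → ℂ)} (hD : D ⊆ ball)
    (hDm : MeasurableSet D) (hpos : d.IsPosDefOn Γ' D) (hfin : FiniteDimensional ℂ (d.CForm Γ' D)) :
    FormAlgebra (d.CForm Γ' D) where
  wedge := d.cWedge Γ' D
  hodge := d.cHodge Γ' hD hDm
  H10 := d.cH10 Γ' D
  H20 := d.cH20 Γ' D
  wedge_mem := fun α β _ _ => by
    rw [mem_cH20]
    rfl
  wedge_self := fun α _ => Subtype.ext (wedgeC_self α.1)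
  hodge_hermitian := fun α β => pairingC_conj D α.1 β.1
  hodge_pos := hpos
  hodge_degree := fun α β hα hβ => by
    rw [mem_cH10] at hα
    rw [mem_cH20] at hβ
    show pairingC D α.1 β.1 = 0
    have hα' : α.1 = (α.1.1, 0) := by rw [← hα]
    have hβ' : β.1 = (0, β.1.2) := by rw [← hβ]
    rw [hα', hβ']
    exact pairingC_degree D α.1.1 β.1.2
  finiteDimensional := hfin

end TargetData

end Summit.Ventures.HodgeRepro.Tier4
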